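import Mathlib
import Summits.KontsevichZagierPeriods.KontsevichZagierPeriods.Theorems.InverseLandauTateLiftingSqrtAffineSector
import Summits.KontsevichZagierPeriods.KontsevichZagierPeriods.Theorems.HyperbolicBlochOffTetraSectorKernelRungZeroIntervals

/-!
# `TateLifting` (stmt-KontsevichZagierPeriods-9129), line `Sketch` — stub 41 `tateLifting_conicDegenerate`

DEGENERATE CONICS ARE PIECEWISE RATIONAL. Let `K = ℚ̄ ∩ ℝ = algebraicClosure ℚ ℝ` be the field of
real algebraic numbers and let `r = [σ, P(x, √q(x))/Q(x, √q(x))]` be a one-dimensional conic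
representation: `q = ax² + bx + c ∈ K[x]`, `q > 0` on `σ`, `P, Q ∈ K[X₀, X₁]`, `Q(x, √q(x)) ≠ 0` on
`σ`. If the conic `y² = q(x)` is DEGENERATE, `b² = 4ac`, no Euler substitution is needed to reach
the landed dimension-one algebraic ("Baker") sector, whose generators are the point
representations and the dimension-one representations read on their domain by `p(x)/q(x)`,
`p, q ∈ ℝ[x]` with real-algebraic coefficients, `q ≠ 0` there:

* if `a = 0` then `b = 0` and `q = c` is constant, `√q = √c ∈ K`, so the integrand of `r` is on
  `σ` the value at `x` of `P(X, √c)/Q(X, √c) ∈ K(X)`: `r` itself is a generator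
  (`ConicDegenerate.cd_generator` with the constant polynomial `√c`), `[r] − [r] = 0`;
* if `a ≠ 0` then `q = a(x − ρ)²` with `ρ = −b/(2a) ∈ K` (`ConicDegenerate.cd_complete_square`),
  positivity of `q` on `σ` gives `x ≠ ρ` there, and `√q(x) = √a · |x − ρ|` with `√a ∈ K`
  (`rungZero_isAlgebraic_sqrt`). ONE domain-additivity move (Kontsevich–Zagier's rule
  (1), `KZ.domainAddRel`) splits `σ = σ₊ ∪ σ₋` at `ρ`, `σ₊ = σ ∩ {x > ρ}`, `σ₋ = σ ∩ {x < ρ}`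
  (`ℚ`-semialgebraic, `ConicDegenerate.cd_isSemialgebraic_gt/lt`), `[r] − [r|σ₊] − [r|σ₋] ∈
  KZ.relations`; on `σ₊` the integrand is the value at `x` of `P(X, √a(X − ρ))/Q(X, √a(X − ρ))`, on
  `σ₋` of `P(X, √a(ρ − X))/Q(X, √a(ρ − X))`, so both restrictions are generators.

References: M. Kontsevich, D. Zagier, *Periods* (2001), §1.2 rule (1).
-/

noncomputable section

open MeasureTheory Set Polynomial
open Literature.NumberTheory.Transcendental
open Literature.ModelTheory.ExponentialFields (IsSemialgebraic)
open Summit.KontsevichZagierPeriods.HyperbolicBloch.OffTetraSectorKernel (rungZero_isAlgebraic_sqrt)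

namespace Summit.KontsevichZagierPeriods.InverseLandau

namespace ConicDegenerate

/-- Evaluating at a real `t` the real polynomial attached to the substitution `X₀ ↦ X, X₁ ↦ g` of
`P ∈ K[X₀, X₁]` (`K = ℚ̄ ∩ ℝ`, `g ∈ K[X]`) is evaluating `P` at `(t, g(t))`. [folklore] -/
theorem cd_eval_map_aeval (g : (algebraicClosure ℚ ℝ)[X])
    (P : MvPolynomial (Fin 2) (algebraicClosure ℚ ℝ)) (t : ℝ) :
    ((MvPolynomial.aeval (![X, g] : Fin 2 → (algebraicClosure ℚ ℝ)[X]) P).map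
        (algebraMap (algebraicClosure ℚ ℝ) ℝ)).eval t =
      MvPolynomial.aeval ![t, Polynomial.aeval t g] P := by
  have hg : (fun i => Polynomial.aeval t ((![X, g] : Fin 2 → (algebraicClosure ℚ ℝ)[X]) i)) =
      ![t, Polynomial.aeval t g] := by
    funext i
    fin_cases i <;> simp
  rw [Polynomial.eval_map, ← Polynomial.aeval_def, ← AlgHom.comp_apply, MvPolynomial.comp_aeval, hg]

/-- **Polynomial readings are generators.** If on the domain of a one-dimensional representation
`r` a function `s` is read by a polynomial `g ∈ K[X]` (`K = ℚ̄ ∩ ℝ`), `s(x) = g(x)`, and the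
integrand of `r` is `P(x, s(x))/Q(x, s(x))` with `P, Q ∈ K[X₀, X₁]`, `Q(x, s(x)) ≠ 0`, then `r` is a
generator of the dimension-one algebraic sector: its integrand is read by the real polynomials
`P(X, g).map (K → ℝ)`, `Q(X, g).map (K → ℝ)`, with real-algebraic coefficients
(`DimOne.uc_isAlgebraic_coeff`). [folklore] -/
theorem cd_generator (r : KZ.IntegralRep 1) (P Q : MvPolynomial (Fin 2) (algebraicClosure ℚ ℝ))
    (g : (algebraicClosure ℚ ℝ)[X]) (s : (Fin 1 → ℝ) → ℝ)
    (hs : ∀ x ∈ r.domain, s x = Polynomial.aeval (x 0) g)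
    (hQ : ∀ x ∈ r.domain, (MvPolynomial.aeval ![x 0, s x] Q : ℝ) ≠ 0)
    (hPQ : Set.EqOn r.integrand
      (fun x => (MvPolynomial.aeval ![x 0, s x] P : ℝ) / MvPolynomial.aeval ![x 0, s x] Q)
      r.domain) :
    KZ.of r ∈ {d : KZ.FormalRep | (∃ r : KZ.IntegralRep 0, d = KZ.of r) ∨
      ∃ (r : KZ.IntegralRep 1) (p q : Polynomial ℝ), (∀ i, IsAlgebraic ℚ (p.coeff i)) ∧
        (∀ i, IsAlgebraic ℚ (q.coeff i)) ∧ (∀ x ∈ r.domain, q.eval (x 0) ≠ 0) ∧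
        Set.EqOn r.integrand (fun x => p.eval (x 0) / q.eval (x 0)) r.domain ∧ d = KZ.of r} := by
  refine Or.inr ⟨r,
    (MvPolynomial.aeval (![X, g] : Fin 2 → (algebraicClosure ℚ ℝ)[X]) P).map
      (algebraMap (algebraicClosure ℚ ℝ) ℝ),
    (MvPolynomial.aeval (![X, g] : Fin 2 → (algebraicClosure ℚ ℝ)[X]) Q).map
      (algebraMap (algebraicClosure ℚ ℝ) ℝ),
    DimOne.uc_isAlgebraic_coeff _, DimOne.uc_isAlgebraic_coeff _, fun x hx => ?_, fun x hx => ?_,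
    rfl⟩
  · rw [cd_eval_map_aeval, ← hs x hx]
    exact hQ x hx
  · show r.integrand x = _ / _
    rw [cd_eval_map_aeval, cd_eval_map_aeval, ← hs x hx]
    exact hPQ hx

/-- The right half `σ ∩ {x > ρ}` of a `ℚ`-semialgebraic `σ ⊆ ℝ¹` cut at a real algebraic `ρ` is
`ℚ`-semialgebraic (the sign set of the semialgebraic function `ρ − x`). [folklore] -/
theorem cd_isSemialgebraic_gt {σ : Set (Fin 1 → ℝ)} (hσ : IsSemialgebraic ℚ σ) {ρ : ℝ}
    (hρ : IsAlgebraic ℚ ρ) : IsSemialgebraic ℚ {x | x ∈ σ ∧ ρ < x 0} := by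
  convert (IsSemialgebraicFunOn.sub_holds (isSemialgebraicFunOn_const_of_isAlgebraic hσ hρ)
    (isSemialgebraicFunOn_apply hσ 0)).isSemialgebraic_sep_neg using 1
  ext x
  simp [sub_neg]

/-- The left half `σ ∩ {x < ρ}` of a `ℚ`-semialgebraic `σ ⊆ ℝ¹` cut at a real algebraic `ρ` is
`ℚ`-semialgebraic (the sign set of the semialgebraic function `x − ρ`). [folklore] -/
theorem cd_isSemialgebraic_lt {σ : Set (Fin 1 → ℝ)} (hσ : IsSemialgebraic ℚ σ) {ρ : ℝ}
    (hρ : IsAlgebraic ℚ ρ) : IsSemialgebraic ℚ {x | x ∈ σ ∧ x 0 < ρ} := by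
  convert (IsSemialgebraicFunOn.sub_holds (isSemialgebraicFunOn_apply hσ 0)
    (isSemialgebraicFunOn_const_of_isAlgebraic hσ hρ)).isSemialgebraic_sep_neg using 1
  ext x
  simp [sub_neg]

/-- Completing the square on a degenerate conic: if `b² = 4ac`, `a ≠ 0` and `2aρ + b = 0`, then
`at² + bt + c = a(t − ρ)²`. [folklore] -/
theorem cd_complete_square {a b c ρ : ℝ} (ha : a ≠ 0) (hdisc : b ^ 2 - 4 * a * c = 0)
    (hρ : 2 * a * ρ + b = 0) (t : ℝ) : a * t ^ 2 + b * t + c = a * (t - ρ) ^ 2 := by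
  have key : 4 * a * (a * t ^ 2 + b * t + c) = 4 * a * (a * (t - ρ) ^ 2) := by
    linear_combination (4 * a * t + b - 2 * a * ρ) * hρ + (-1 : ℝ) * hdisc
  exact mul_left_cancel₀ (mul_ne_zero four_ne_zero ha) key

end ConicDegenerate

open ConicDegenerate in
/-- **Degenerate conics are piecewise rational** (stub 41 `tateLifting_conicDegenerate` of the
lead's skeleton): a conic representation `r = [σ, P(x, √q)/Q(x, √q)]`, `q = ax² + bx + c` over
`K = ℚ̄ ∩ ℝ` with `b² = 4ac`, `q > 0` and `Q(x, √q) ≠ 0` on `σ`, differs by relations from an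
element of the subgroup generated by the dimension-≤-1 algebraic sector. If `a = 0` then `q = c`
and `√q = √c ∈ K`: `r` is a generator. If `a ≠ 0` then `√q = √a |x − ρ|`, `ρ = −b/(2a)`, `x ≠ ρ` on
`σ`, and ONE domain-additivity move `σ = (σ ∩ {x > ρ}) ∪ (σ ∩ {x < ρ})` (rule (1)) exhibits
`[r] ≡ [r|σ₊] + [r|σ₋]`, two generators (integrands `P(x, ±√a(x − ρ))/Q(x, ±√a(x − ρ))`).
[cite: KontsevichZagier2001, §1.2 rule (1)] -/
theorem tateLifting_conicDegenerate :
    ∀ (a b c : algebraicClosure ℚ ℝ) (P Q : MvPolynomial (Fin 2) (algebraicClosure ℚ ℝ))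
      (r : KZ.IntegralRep 1), (b : ℝ) ^ 2 - 4 * (a : ℝ) * c = 0 →
      (∀ x ∈ r.domain, 0 < (a : ℝ) * x 0 ^ 2 + (b : ℝ) * x 0 + c) →
      (∀ x ∈ r.domain,
        (MvPolynomial.aeval ![x 0, Real.sqrt ((a : ℝ) * x 0 ^ 2 + (b : ℝ) * x 0 + c)] Q : ℝ) ≠ 0) →
      Set.EqOn r.integrand (fun x =>
        (MvPolynomial.aeval ![x 0, Real.sqrt ((a : ℝ) * x 0 ^ 2 + (b : ℝ) * x 0 + c)] P : ℝ) /
          MvPolynomial.aeval ![x 0, Real.sqrt ((a : ℝ) * x 0 ^ 2 + (b : ℝ) * x 0 + c)] Q) r.domain →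
      ∃ ℓ ∈ AddSubgroup.closure
          {d : KZ.FormalRep | (∃ r : KZ.IntegralRep 0, d = KZ.of r) ∨
            ∃ (r : KZ.IntegralRep 1) (p q : Polynomial ℝ), (∀ i, IsAlgebraic ℚ (p.coeff i)) ∧
              (∀ i, IsAlgebraic ℚ (q.coeff i)) ∧ (∀ x ∈ r.domain, q.eval (x 0) ≠ 0) ∧
              Set.EqOn r.integrand (fun x => p.eval (x 0) / q.eval (x 0)) r.domain ∧ d = KZ.of r},
        KZ.of r - ℓ ∈ KZ.relations := by
  intro a b c P Q r hdisc hpos hQ hPQ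
  by_cases ha : (a : ℝ) = 0
  · -- `a = 0`: then `b = 0`, `q = c` is constant and `√q = √c ∈ K`; `r` itself is a generator
    have hb : (b : ℝ) = 0 := by
      rw [ha, mul_zero, zero_mul, sub_zero] at hdisc
      exact (pow_eq_zero_iff two_ne_zero).1 hdisc
    have hsq : ∀ x : Fin 1 → ℝ,
        Real.sqrt ((a : ℝ) * x 0 ^ 2 + (b : ℝ) * x 0 + c) = Real.sqrt c := by
      intro x
      rw [ha, hb, zero_mul, zero_mul, zero_add, zero_add]
    have hcK : Real.sqrt (c : ℝ) ∈ algebraicClosure ℚ ℝ :=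
      mem_algebraicClosure_iff.2 (rungZero_isAlgebraic_sqrt (mem_algebraicClosure_iff.1 c.2))
    refine ⟨KZ.of r, AddSubgroup.subset_closure (cd_generator r P Q (C ⟨Real.sqrt c, hcK⟩)
      (fun x => Real.sqrt ((a : ℝ) * x 0 ^ 2 + (b : ℝ) * x 0 + c)) (fun x _ => ?_) hQ hPQ), ?_⟩
    · show Real.sqrt _ = _
      rw [hsq, Polynomial.aeval_C, IntermediateField.algebraMap_apply]
    · rw [sub_self]
      exact KZ.relations.zero_mem
  · -- `a ≠ 0`: `q = a(x − ρ)²`, `√q = √a |x − ρ|`, split the domain at `ρ`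
    have haK : IsAlgebraic ℚ (a : ℝ) := mem_algebraicClosure_iff.1 a.2
    obtain ⟨ρ, hρK, hρ⟩ : ∃ ρ : ℝ, ρ ∈ algebraicClosure ℚ ℝ ∧ 2 * (a : ℝ) * ρ + b = 0 := by
      refine ⟨-(b : ℝ) / (2 * a), div_mem (neg_mem b.2) (mul_mem (ofNat_mem _ 2) a.2), ?_⟩
      field_simp
      ring
    have hρa : IsAlgebraic ℚ ρ := mem_algebraicClosure_iff.1 hρK
    have hq : ∀ t : ℝ, (a : ℝ) * t ^ 2 + (b : ℝ) * t + c = a * (t - ρ) ^ 2 :=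
      cd_complete_square ha hdisc hρ
    have hsqrt : ∀ t : ℝ,
        Real.sqrt ((a : ℝ) * t ^ 2 + (b : ℝ) * t + c) = Real.sqrt a * |t - ρ| := by
      intro t
      rw [hq t, Real.sqrt_mul' _ (sq_nonneg _), Real.sqrt_sq_eq_abs]
    have hne : ∀ x ∈ r.domain, x 0 ≠ ρ := by
      intro x hx h0
      have h := hpos x hx
      rw [hq, h0, sub_self, zero_pow two_ne_zero, mul_zero] at h
      exact lt_irrefl _ h
    have haK' : Real.sqrt (a : ℝ) ∈ algebraicClosure ℚ ℝ :=
      mem_algebraicClosure_iff.2 (rungZero_isAlgebraic_sqrt haK)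
    -- the two halves `σ₊ = σ ∩ {x > ρ}`, `σ₋ = σ ∩ {x < ρ}` and the restricted representations
    have h₁ : IsSemialgebraic ℚ {x | x ∈ r.domain ∧ ρ < x 0} :=
      cd_isSemialgebraic_gt r.isSemialgebraic_domain hρa
    have h₂ : IsSemialgebraic ℚ {x | x ∈ r.domain ∧ x 0 < ρ} :=
      cd_isSemialgebraic_lt r.isSemialgebraic_domain hρa
    obtain ⟨r₁, hd₁, hi₁⟩ : ∃ r₁ : KZ.IntegralRep 1,
        r₁.domain = {x | x ∈ r.domain ∧ ρ < x 0} ∧ r₁.integrand = r.integrand :=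
      ⟨r.restrict _ h₁ fun x hx => hx.1, rfl, rfl⟩
    obtain ⟨r₂, hd₂, hi₂⟩ : ∃ r₂ : KZ.IntegralRep 1,
        r₂.domain = {x | x ∈ r.domain ∧ x 0 < ρ} ∧ r₂.integrand = r.integrand :=
      ⟨r.restrict _ h₂ fun x hx => hx.1, rfl, rfl⟩
    -- ONE domain-additivity move: `[r] − [r|σ₊] − [r|σ₋] ∈ relations`
    have hrel : KZ.of r - KZ.of r₁ - KZ.of r₂ ∈ KZ.relations := by
      refine KZ.domainAddRel_subset_relations ⟨1, r, r₁, r₂, ?_, ?_,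
        fun x _ => by rw [hi₁], fun x _ => by rw [hi₂], rfl⟩
      · rw [hd₁, hd₂]
        ext x
        simp only [mem_union, mem_setOf_eq]
        constructor
        · intro hx
          rcases lt_or_gt_of_ne (hne x hx) with h | h
          · exact Or.inr ⟨hx, h⟩
          · exact Or.inl ⟨hx, h⟩
        · rintro (hx | hx) <;> exact hx.1
      · rw [hd₁, hd₂]
        refine measure_mono_null (fun x hx => ?_) measure_empty
        exact lt_irrefl _ (hx.1.2.trans hx.2.2)
    -- both halves are generators: `√q = √a (x − ρ)` on `σ₊`, `√q = √a (ρ − x)` on `σ₋`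
    have hg₁ := cd_generator r₁ P Q (C ⟨Real.sqrt a, haK'⟩ * (X - C ⟨ρ, hρK⟩))
      (fun x => Real.sqrt ((a : ℝ) * x 0 ^ 2 + (b : ℝ) * x 0 + c)) (by
        rw [hd₁]
        rintro x ⟨-, hx⟩
        show Real.sqrt _ = _
        rw [hsqrt, abs_of_pos (sub_pos.2 hx), map_mul, map_sub, Polynomial.aeval_C,
          Polynomial.aeval_C, Polynomial.aeval_X, IntermediateField.algebraMap_apply,
          IntermediateField.algebraMap_apply])
      (by rw [hd₁]; exact fun x hx => hQ x hx.1) (by rw [hd₁, hi₁]; exact fun x hx => hPQ hx.1)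
    have hg₂ := cd_generator r₂ P Q (C ⟨Real.sqrt a, haK'⟩ * (C ⟨ρ, hρK⟩ - X))
      (fun x => Real.sqrt ((a : ℝ) * x 0 ^ 2 + (b : ℝ) * x 0 + c)) (by
        rw [hd₂]
        rintro x ⟨-, hx⟩
        show Real.sqrt _ = _
        rw [hsqrt, abs_sub_comm, abs_of_pos (sub_pos.2 hx), map_mul, map_sub, Polynomial.aeval_C,
          Polynomial.aeval_C, Polynomial.aeval_X, IntermediateField.algebraMap_apply,
          IntermediateField.algebraMap_apply])
      (by rw [hd₂]; exact fun x hx => hQ x hx.1) (by rw [hd₂, hi₂]; exact fun x hx => hPQ hx.1)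
    refine ⟨KZ.of r₁ + KZ.of r₂,
      add_mem (AddSubgroup.subset_closure hg₁) (AddSubgroup.subset_closure hg₂), ?_⟩
    rw [← sub_sub]
    exact hrel

end Summit.KontsevichZagierPeriods.InverseLandau

end
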